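import Mathlib.GroupTheory.Subgroup.Center
import Mathlib.Algebra.Group.End
import Mathlib.GroupTheory.GroupAction.Defs
import Mathlib.Data.Real.Basic
import HarnessLib

/-!
# Kottwitz 1984 (Math. Ann.), §1: points on `S_K` over finite fields and twisted orbital integrals (typed skeleton)

R. E. Kottwitz, *Shimura varieties and twisted orbital integrals*, Math. Ann. 269 (1984) 287–300 [Kottwitz1984TwistedOrbital],
§1 «Points on `S_K` over finite fields», pp. 287–293.  Source: the open GDZ digitisation (volume PPN235181684_0269, article LOG_0031;
lit key `paper:url-15572740aaa4` = image-only PDF, PDF page n = printed p. 285+n; per-page OCR canvas NNN = printed p. NNN−4; the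
displays below were read on the page IMAGES of pp. 287, 289–292, cell folder `T/KOT/TK-t08/g0/Kottwitz1984TwistedOrbital-GDZ/`).
Quotations are AS PRINTED.  Carpet file of squad TK (cell `pub/hodgecm-mathlib`, seat TK-t08): STATEMENTS ONLY — no proof, no
`sorry`, no axiom, no instance, no notation.

WHAT IS TYPED, AND HOW.
(A) CONCRETELY, over Mathlib group actions (the combinatorial heart of §1.4, which is pure group theory once Langlands' description
(1.3.1) is granted): the smallness conditions (1.3.7), (1.3.8) on `K` (`Small137`, `Small138`), the set `A` of (1.4.1) (`fixedPointData`),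
the sets `Y_p`, `Y^p` of (1.4.4) (`Yp`, `YP`) with the identity (1.4.4) (`Eq144`), the bijection (1.4.2)
`(Z(ℚ)_K × I(ℚ))\A → [I(ℚ)\(X_p × X^p)]^Φ` (`Surj142`, `Inj142`), the stabilizer computation behind (1.4.3) (`Stab143`), and
**Lemma 1.4.9** (`Lemma149`) for an abstract group `G(L)` with an automorphism `σ` acting compatibly on a `G(L)`-set `V(L)`.  These are
predicates with explicit parameters; nothing is asserted, but (1.4.2)–(1.4.4) are provable as stated and Lemma 1.4.9 holds for the
book's data (its proof uses that `x₀` is hyperspecial and Greenberg's theorem).  Also CONCRETELY: the descent statement (1.1.3.1) inside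
the proof of Lemma 1.1.3 — its surjectivity half (`Surj1131`), for a set with commuting-up-to-twist actions of a «Weyl group» `Ω` and a
«Galois group» `Γ` and a `Γ`-stable fundamental domain.
(B) As a TYPED SKELETON (style of `Literature/NumberTheory/Kottwitz1992/TotalFixedPoints.lean`): **Lemma 1.1.3** over carriers for the
sets `𝓜(·)` of conjugacy classes of cocharacters (`CocharClassDatum.Lemma113a/b`), and the COUNT (1.5.3)–(1.5.7)
`Card(I_h(ℚ)\A_h) = a · TO_δ(φ_p) · O_h(f^p)` over carriers for the measure-theoretic quantities (`CountDatum.Eq154`).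

THE PRINT.  (p. 287) «We consider the Shimura variety `S_K` associated to a connected reductive group `G` over `ℚ`, a `G(ℝ)`-conjugacy
class `X_∞` of homomorphisms `h : Res_{ℂ/ℝ}(𝔾_m) → G_ℝ`, and a sufficiently small compact open subgroup `K` of `G(𝔸_f)` (see [D]). For
technical reasons we assume that the derived group of `G` is simply connected. Recall that (1.1.1) `S_K(ℂ) = G(ℚ)\(X_∞ × (G(𝔸_f)/K))`.
[…] (1.1.2) The representation `Ad ∘ μ` of `𝔾_m` on `Lie(G_ℂ)` has no weights other than `1, 0, −1`. For any field `F` containing `ℚ`,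
we write `𝓜(F)` for the set of `G(F)`-conjugacy classes of homomorphisms `𝔾_m → G_F`. […] (1.1.3) Lemma. Let `F` be a field containing
`ℚ`, and let `F̄` be an algebraic closure of `F`. (a) Assume that `G` is quasi-split over `F`. Then `𝓜(F) = 𝓜(F̄)^{Gal(F̄/F)}`.
Furthermore, for any maximal `F`-split torus `S` of `G_F`, with relative Weyl group `Ω_F`, we have `X_*(S)/Ω_F ⥲ 𝓜(F)`. (b) Let `F'` be
an algebraically closed field containing `F̄`. Then `𝓜(F̄) = 𝓜(F')`.»  (p. 288, proof: «we are reduced to proving that (1.1.3.1)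
`X_*(S)/Ω_F ⥲ [X_*(T)/Ω]^{Gal(F̄/F)}`, where `Ω` denotes the absolute Weyl group of `T` in `G`. Choose a Borel `F`-subgroup `B`
containing `T`, and let `C` denote the `B`-positive Weyl chamber […] Since `C` is a fundamental domain for the action of `Ω` on
`X_*(T) ⊗ ℝ`, it follows that `σμ = μ`».)  (p. 289) «Langlands conjectures that `S_K(k̄)` is a disjoint union of subsets of the form
(1.3.1) `I(ℚ)\(X_p × X^p)`. The group `I` is a connected reductive `ℚ`-group and comes with an embedding over `𝔸_f^p` (1.3.2) `I → G`.
The set `X^p` is equal to `G(𝔸_f^p)/K^p`. The set `X_p` is obtained from an element `b ∈ G(L)`. For any field `F` between `ℚ_p` and `L` we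
write `V(F)` for the `G(F)`-orbit of `x₀` in the building of `G` over `F`. We write `σ` for the Frobenius automorphism of `L` over `ℚ_p`.
There is an action on `V(L)` of the semidirect product of `G(L)` and `⟨σ⟩` […] (1.3.3) `inv : V(L) × V(L) → 𝓜(L)` […] (1.3.4)
`X_p = {x ∈ V(L) | inv(bσx, x) = M_v}`. […] (1.3.5) `J(ℚ_p) = {g ∈ G(L) | (bσ)g = g(bσ)}`. […] (1.3.6) `I → J`.»  (p. 290) «Let `Z`
denote the center of `G` […] We write `Z_K` for `Z(𝔸_f) ∩ K` and `Z(ℚ)_K` for `Z(ℚ) ∩ K`. For sufficiently small `K`, the following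
two conditions [L3, pp. 1171–1172] hold: (1.3.7) If `h ∈ I(ℚ)` fixes a point of `X_p × X^p`, then `h ∈ Z(ℚ)_K`. (1.3.8) Let
`h, g ∈ I(ℚ)`, `z ∈ Z(ℚ)_K`, and suppose that `ghg⁻¹ = hz`. Then `z = 1`. […] Let `n = [k' : 𝔽_p]` and `Φ = (bσ)^n`. Then the part
of `S_K(k')` coming from the subset (1.3.1) of `S_K(k̄)` is given by the set of fixed points `[I(ℚ)\(X_p × X^p)]^Φ` […] the set `A`,
which consists of all `(h, x, y) ∈ I(ℚ) × X_p × X^p` such that `(Φx, y) = (hx, hy)`. There is an obvious projection map (1.4.1)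
`A → X_p × X^p`. The groups `I(ℚ)` and `Z(ℚ)_K` act on `A`: (a) `g·(h, x, y) = (ghg⁻¹, gx, gy)` for `g ∈ I(ℚ)`, (b)
`z·(h, x, y) = (zh, x, y)` for `z ∈ Z(ℚ)_K`. […] The assumption (1.3.7) on `K` implies that (1.4.1) induces a bijection from (1.4.2)
`(Z(ℚ)_K × I(ℚ))\A` to `[I(ℚ)\X_p × X^p]^Φ`. […] Using assumption (1.3.8), we see that the stabilizer of `h ∈ I(ℚ)` in `I(ℚ) × Z(ℚ)_K`
is `I_h(ℚ)`, where `I_h` denotes the centralizer of `h` in `I`. Therefore the set (1.4.2) is equal to (1.4.3) `∐_h I_h(ℚ)\A_h`, where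
`h` runs through a set of representatives for the conjugacy classes in `I(ℚ)/Z(ℚ)_K` and `A_h` denotes the fiber of `A → I(ℚ)` over `h`.
We have (1.4.4) `A_h = Y_p × Y^p`, where `Y_p = {x ∈ X_p | h⁻¹Φx = x}` and `Y^p = {y ∈ X^p | hy = y}`.»  (p. 291) «(1.4.9) Lemma. Let `Ψ`
be an element of the semidirect product of `⟨σ⟩` and `G(L)`, and assume that `Ψ` projects to a non-trivial element of `⟨σ⟩`. Then `Ψ`
is conjugate under `G(L)` to an element of `⟨σ⟩` if and only if `Ψ` fixes some element of `V(L)`.» («If `Ψ = cσ^m c⁻¹` for some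
`c ∈ G(L)`, then `Ψ` fixes `cx₀ ∈ V(L)`. Conversely […] Since `x₀` is hyperspecial, the reduction modulo `p` of `G` is connected, and by
a result of Greenberg [G] there exists `c ∈ G(𝔬_L)` such that `g = cτ(c⁻¹)`.»)  (p. 292) «Let `φ_p` (resp. `f^p`) denote the
characteristic function of `D` in `G(F)` [resp. of `K^p` in `G(𝔸_f^p)`]. The cardinality of `I_h(ℚ)\A_h` is equal to (1.5.3)
`∫ φ_p(g₁⁻¹δσ(g₁)) f^p(g₂⁻¹hg₂) dg₁dg₂/dx`, where the integral is taken over `I_h(ℚ)Z_K\G(F) × G(𝔸_f^p)`, `dg₁` (resp. `dg₂`) is the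
Haar measure on `G(F)` [resp. `G(𝔸_f^p)`] that gives `K_p(F)` (resp. `K^p`) measure `1`, and `dx` is the Haar measure on `I_h(ℚ)Z_K`
that gives `Z_K` measure `1`. […] We can rewrite (1.5.3) as (1.5.4) `a · TO_δ(φ_p) · O_h(f^p)`, where (1.5.5)
`a = meas(I_h(ℚ)Z_K\I_h(𝔸_f))`, (1.5.6) `TO_δ(φ_p) = ∫_{G_δ^σ(ℚ_p)\G(F)} φ_p(g⁻¹δσ(g))`, (1.5.7) `O_h(f^p) = ∫_{G_h(𝔸_f^p)\G(𝔸_f^p)} f^p(g⁻¹hg)`.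
To get (1.5.5) we used (1.4.7), (1.4.8) and (1.4.12) to replace `G_δ^σ(ℚ_p) × G_h(𝔸_f^p)` by `I_h(𝔸_f)`.»

NOT typed: (1.1.1), (1.1.2) and §1.2 (setting); Langlands' conjectural description (1.3.1)–(1.3.6) itself (a standing assumption of the
paper, «We will assume the truth of this conjecture», p. 289) beyond the carriers it provides; (1.4.7), (1.4.8), (1.4.10)–(1.4.14) (the
re-indexing `Φ ↝ δσ`, `Y_p ↝ Y_p'` inside the computation); (1.5.1)–(1.5.2) (the coset sum rewritten as (1.5.3)); §§1.6–1.7 (discussion).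
HC_CM is proved only modulo the printed citations until rung 0 closes; this file discharges none of them.

## References
* [Kottwitz1984TwistedOrbital] R. E. Kottwitz, *Shimura varieties and twisted orbital integrals*, Math. Ann. 269 (1984) 287–300, §1:
  Lemma 1.1.3 p. 287 (proof, (1.1.3.1), p. 288); (1.3.1)–(1.3.8) pp. 289–290; (1.4.1)–(1.4.6) p. 290; Lemma 1.4.9, (1.4.7)–(1.4.14)
  p. 291; (1.5.1)–(1.5.7) p. 292.
* [Kottwitz1992] R. E. Kottwitz, *Points on some Shimura varieties over finite fields*, JAMS 5 (1992), §16 and §19 (the generalisation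
  to PEL moduli problems; tree: `Literature/NumberTheory/Kottwitz1992/TotalFixedPoints.lean`).
-/

namespace Literature.NumberTheory.Kottwitz1984TwistedOrbital.PointsModP

universe u v w

/-! ## (A) §1.4 concretely: the fixed-point combinatorics of `Φ = (bσ)^n` on `I(ℚ)\(X_p × X^p)` -/

section FixedPoints

variable {I : Type u} [Group I] {Xp : Type v} {XP : Type w} [MulAction I Xp] [MulAction I XP]

/-- **(1.3.7)** (p. 290): «If `h ∈ I(ℚ)` fixes a point of `X_p × X^p`, then `h ∈ Z(ℚ)_K`.»  Parameters: the group `I = I(ℚ)` acting on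
`X_p` and on `X^p`, the subgroup `Z(ℚ)_K`. [cite: Kottwitz1984TwistedOrbital, (1.3.7) (p. 290)] -/
def Small137 (ZK : Subgroup I) : Prop :=
  ∀ h : I, (∃ (x : Xp) (y : XP), h • x = x ∧ h • y = y) → h ∈ ZK

/-- **(1.3.8)** (p. 290): «Let `h, g ∈ I(ℚ)`, `z ∈ Z(ℚ)_K`, and suppose that `ghg⁻¹ = hz`. Then `z = 1`.»
[cite: Kottwitz1984TwistedOrbital, (1.3.8) (p. 290)] -/
def Small138 (ZK : Subgroup I) : Prop :=
  ∀ h g : I, ∀ z ∈ ZK, g * h * g⁻¹ = h * z → z = 1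

/-- **The set `A`** (p. 290): «all `(h, x, y) ∈ I(ℚ) × X_p × X^p` such that `(Φx, y) = (hx, hy)`», for a self-map `Φ` of `X_p` (in the
paper `Φ = (bσ)^n`, which commutes with the action of `I(ℚ)`). [cite: Kottwitz1984TwistedOrbital, §1.4 (1.4.1) (p. 290)] -/
def fixedPointData (Φ : Xp → Xp) : Set (I × Xp × XP) :=
  {t | Φ t.2.1 = t.1 • t.2.1 ∧ t.2.2 = t.1 • t.2.2}

/-- **`Y_p = {x ∈ X_p | h⁻¹Φx = x}`** (p. 290, (1.4.4)). [cite: Kottwitz1984TwistedOrbital, (1.4.4) (p. 290)] -/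
def Yp (Φ : Xp → Xp) (h : I) : Set Xp :=
  {x | h⁻¹ • Φ x = x}

/-- **`Y^p = {y ∈ X^p | hy = y}`** (p. 290, (1.4.4)). [cite: Kottwitz1984TwistedOrbital, (1.4.4) (p. 290)] -/
def YP (h : I) : Set XP :=
  {y | h • y = y}

/-- **(1.4.4)** (p. 290): «`A_h = Y_p × Y^p`», `A_h` the fibre of `A → I(ℚ)` over `h`.  (Provable from the definitions: `Φx = hx` iff
`h⁻¹Φx = x`.)  Nothing is asserted. [cite: Kottwitz1984TwistedOrbital, (1.4.4) (p. 290)] -/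
def Eq144 (Φ : Xp → Xp) : Prop :=
  ∀ h : I, {q : Xp × XP | (h, q) ∈ fixedPointData (I := I) Φ} = Yp Φ h ×ˢ YP h

/-- **(1.4.2), surjectivity half** (p. 290): the projection (1.4.1) `A → X_p × X^p` maps ONTO the `Φ`-fixed points of
`I(ℚ)\(X_p × X^p)` — the `I(ℚ)`-orbit of `(x, y)` is carried into itself by `Φ` (acting on the first factor: every `(Φ(gx), gy)` lies in
the orbit) iff `(h, x, y) ∈ A` for some `h`.  (With `Φ` commuting with `I(ℚ)`, immediate from the definitions.)  Nothing is asserted.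
[cite: Kottwitz1984TwistedOrbital, (1.4.2) (p. 290)] -/
def Surj142 (Φ : Xp → Xp) : Prop :=
  (∀ (g : I) (x : Xp), Φ (g • x) = g • Φ x) →
    ∀ (x : Xp) (y : XP),
      (∀ g : I, ∃ g' : I, Φ (g • x) = g' • x ∧ g • y = g' • y) ↔ ∃ h : I, (h, x, y) ∈ fixedPointData (I := I) Φ

/-- **(1.4.2), injectivity half** (p. 290): «The assumption (1.3.7) on `K` implies that (1.4.1) induces a bijection from
`(Z(ℚ)_K × I(ℚ))\A` to `[I(ℚ)\X_p × X^p]^Φ`» — two elements of `A` have the same image in `I(ℚ)\(X_p × X^p)` iff they are in the same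
orbit of `Z(ℚ)_K × I(ℚ)` acting by `g·(h, x, y) = (ghg⁻¹, gx, gy)`, `z·(h, x, y) = (zh, x, y)` (for `Φ` commuting with `I(ℚ)`;
provable from (1.3.7) as stated).  Nothing is asserted. [cite: Kottwitz1984TwistedOrbital, (1.4.2) (p. 290)] -/
def Inj142 (ZK : Subgroup I) (Φ : Xp → Xp) : Prop :=
  (∀ (g : I) (x : Xp), Φ (g • x) = g • Φ x) → Small137 (Xp := Xp) (XP := XP) ZK →
    ∀ t ∈ fixedPointData (I := I) (XP := XP) Φ, ∀ t' ∈ fixedPointData (I := I) (XP := XP) Φ,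
      (∃ g : I, t'.2.1 = g • t.2.1 ∧ t'.2.2 = g • t.2.2) ↔
        ∃ g : I, ∃ z ∈ ZK, t'.1 = z * (g * t.1 * g⁻¹) ∧ t'.2.1 = g • t.2.1 ∧ t'.2.2 = g • t.2.2

/-- **The stabilizer computation behind (1.4.3)** (p. 290): «Using assumption (1.3.8), we see that the stabilizer of `h ∈ I(ℚ)` in
`I(ℚ) × Z(ℚ)_K` is `I_h(ℚ)`, where `I_h` denotes the centralizer of `h` in `I`» (`I(ℚ)` acting by conjugation, `Z(ℚ)_K` by translation;
`Z(ℚ)_K` is central: «`Z` is also a subgroup of the center of `I`», p. 290).  Nothing is asserted. [cite: Kottwitz1984TwistedOrbital, (1.4.3) (p. 290)] -/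
def Stab143 (ZK : Subgroup I) : Prop :=
  ZK ≤ Subgroup.center I → Small138 ZK → ∀ (h g : I), ∀ z ∈ ZK, z * (g * h * g⁻¹) = h → z = 1 ∧ g * h = h * g

end FixedPoints

/-! ## (A′) Lemma 1.4.9 concretely: elements of `G(L) ⋊ ⟨σ⟩` fixing a vertex -/

/-- **[Kottwitz1984TwistedOrbital, Lemma 1.4.9]** (p. 291), AS PRINTED: «Let `Ψ` be an element of the semidirect product of `⟨σ⟩` and
`G(L)`, and assume that `Ψ` projects to a non-trivial element of `⟨σ⟩`. Then `Ψ` is conjugate under `G(L)` to an element of `⟨σ⟩` if and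
only if `Ψ` fixes some element of `V(L)`.»  TYPED for an abstract group `G` (= `G(L)`), an automorphism `σ` of `G` (Frobenius), a
`G`-set `V` (= `V(L)`, the `G(L)`-orbit of the hyperspecial vertex `x₀`) with a permutation `σV` (the action of `σ` on `V(L)`): the
element `Ψ = g·σ^m`, `m ≠ 0`, acts on `V` by `x ↦ g·σV^m(x)`, and «`Ψ` is `G(L)`-conjugate to an element of `⟨σ⟩`» reads `Ψ = cσ^m c⁻¹`,
i.e. `g = c·σ^m(c)⁻¹`, for some `c ∈ G`.  The hypotheses under which the paper proves it (`σV(gx) = σ(g)σV(x)`, `V = G·x₀`, `x₀`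
hyperspecial, Greenberg's theorem for `G(𝔬_L)`) are the MEANING of the parameters; nothing is asserted.
[cite: Kottwitz1984TwistedOrbital, Lemma 1.4.9 (p. 291)] -/
def Lemma149 (G : Type u) [Group G] (σ : MulAut G) (V : Type v) [MulAction G V] (σV : Equiv.Perm V) : Prop :=
  ∀ (g : G) (m : ℤ), m ≠ 0 →
    ((∃ c : G, g = c * ((σ ^ m) c)⁻¹) ↔ ∃ x : V, g • (σV ^ m) x = x)

/-! ## (A″) (1.1.3.1) concretely: Galois descent of Weyl-group orbits through a stable fundamental domain -/

/-- **(1.1.3.1), surjectivity** (p. 288, the heart of the proof of Lemma 1.1.3 (a)): «`X_*(S)/Ω_F ⥲ [X_*(T)/Ω]^{Gal(F̄/F)}`»; the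
surjectivity is proved from «`C` is a fundamental domain for the action of `Ω` on `X_*(T) ⊗ ℝ`» and «`Gal(F̄/F)` preserves `C`»:
«we consider `μ ∈ X_*(T)` whose `Ω`-orbit is stable under `Gal(F̄/F)`. Without loss of generality we may assume that `μ ∈ C`. […] it
follows that `σμ = μ`. Therefore `μ` belongs to `X_*(S)`».  TYPED abstractly: `Ω` («Weyl group») and `Γ` («Galois group») act on a set `X`
(= `X_*(T)`), `Γ` acts on `Ω` with `γ·(w·x) = (γ·w)·(γ·x)`, and `C ⊆ X` meets every `Ω`-orbit in exactly one point and is `Γ`-stable; THEN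
every `Γ`-stable `Ω`-orbit contains a `Γ`-fixed point (provable as stated).  The injectivity half uses in addition that `C ∩ (X_*(S) ⊗ ℝ)`
is a chamber for `Ω_F`; it is carried by the skeleton `CocharClassDatum.Lemma113a` below, not here.  Nothing is asserted.
[cite: Kottwitz1984TwistedOrbital, Lemma 1.1.3, proof (1.1.3.1) (p. 288)] -/
def Surj1131 (Ω : Type u) (Γ : Type v) (X : Type w) [Group Ω] [Group Γ] [MulAction Ω X] [MulAction Γ X] [MulAction Γ Ω]
    (C : Set X) : Prop :=
  (∀ (γ : Γ) (w : Ω) (x : X), γ • (w • x) = (γ • w) • (γ • x)) →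
    (∀ x : X, ∃! c : X, c ∈ C ∧ ∃ w : Ω, w • x = c) → (∀ (γ : Γ) (c : X), c ∈ C → γ • c ∈ C) →
      ∀ x : X, (∀ γ : Γ, ∃ w : Ω, γ • x = w • x) → ∃ w : Ω, ∀ γ : Γ, γ • (w • x) = w • x

/-! ## (B) Lemma 1.1.3 and the count (1.5.3)–(1.5.7) — typed skeletons -/

/-- **Carriers for Lemma 1.1.3** (p. 287): a connected reductive group `G` over `ℚ`, a field `F ⊇ ℚ` with algebraic closure `F̄` and an
algebraically closed field `F' ⊇ F̄`.  Fields: `MF`, `MFbar`, `MF'` — the sets `𝓜(F)`, `𝓜(F̄)`, `𝓜(F')` of conjugacy classes of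
homomorphisms `𝔾_m → G`; `toBar : 𝓜(F) → 𝓜(F̄)`, `toPrime : 𝓜(F̄) → 𝓜(F')` (extension of scalars); `Gal` — `Gal(F̄/F)` acting on `𝓜(F̄)`
(`galAct`); `IsQuasiSplit` — `G` is quasi-split over `F`; `XS` — `X_*(S)` for a maximal `F`-split torus `S` of `G_F`, with the relative
Weyl group `ΩF` acting (`weylAct`) and the class map `clS : X_*(S) → 𝓜(F)`.
[cite: Kottwitz1984TwistedOrbital, §1.1, Lemma 1.1.3 (p. 287)] -/
structure CocharClassDatum where
  /-- `𝓜(F)` -/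
  MF : Type u
  /-- `𝓜(F̄)` -/
  MFbar : Type u
  /-- `𝓜(F')` -/
  MF' : Type u
  /-- `𝓜(F) → 𝓜(F̄)` -/
  toBar : MF → MFbar
  /-- `𝓜(F̄) → 𝓜(F')` -/
  toPrime : MFbar → MF'
  /-- `Gal(F̄/F)` -/
  Gal : Type u
  /-- its action on `𝓜(F̄)` -/
  galAct : Gal → MFbar → MFbar
  /-- `G` quasi-split over `F` -/
  IsQuasiSplit : Prop
  /-- `X_*(S)` -/
  XS : Type u
  /-- `Ω_F` -/
  ΩF : Type u
  /-- action of `Ω_F` on `X_*(S)` -/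
  weylAct : ΩF → XS → XS
  /-- `X_*(S) → 𝓜(F)` -/
  clS : XS → MF

namespace CocharClassDatum

/-- **[Kottwitz1984TwistedOrbital, Lemma 1.1.3 (a)]** (p. 287), AS PRINTED: «Assume that `G` is quasi-split over `F`. Then
`𝓜(F) = 𝓜(F̄)^{Gal(F̄/F)}`. Furthermore, for any maximal `F`-split torus `S` of `G_F`, with relative Weyl group `Ω_F`, we have
`X_*(S)/Ω_F ⥲ 𝓜(F)`.»  TYPED: `toBar` is a bijection onto the Galois-fixed classes, and `clS` is surjective with fibres the `Ω_F`-orbits.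
Nothing is asserted. [cite: Kottwitz1984TwistedOrbital, Lemma 1.1.3 (a) (p. 287)] -/
def Lemma113a (D : CocharClassDatum.{u}) : Prop :=
  D.IsQuasiSplit →
    (Function.Injective D.toBar ∧ Set.range D.toBar = {m | ∀ γ : D.Gal, D.galAct γ m = m}) ∧
      (Function.Surjective D.clS ∧ ∀ a b : D.XS, D.clS a = D.clS b ↔ ∃ w : D.ΩF, D.weylAct w a = b)

/-- **[Kottwitz1984TwistedOrbital, Lemma 1.1.3 (b)]** (p. 287), AS PRINTED: «Let `F'` be an algebraically closed field containing `F̄`. Then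
`𝓜(F̄) = 𝓜(F')`.»  TYPED: `toPrime` is a bijection. Nothing is asserted. [cite: Kottwitz1984TwistedOrbital, Lemma 1.1.3 (b) (p. 287)] -/
def Lemma113b (D : CocharClassDatum.{u}) : Prop :=
  Function.Bijective D.toPrime

end CocharClassDatum

/-- **Carriers for the count of §1.5** (p. 292), for a fixed `h ∈ I(ℚ)` satisfying (1.4.5), (1.4.6), with `c`, `δ` as in (1.4.10),
(1.4.11): `cardQuot = Card(I_h(ℚ)\A_h)` (a natural number); `a = meas(I_h(ℚ)Z_K\I_h(𝔸_f))` (1.5.5);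
`twistedOrb = TO_δ(φ_p) = ∫_{G_δ^σ(ℚ_p)\G(F)} φ_p(g⁻¹δσ(g))` (1.5.6), `φ_p` the characteristic function of the double coset `D` of
`K_p(F)` in `G(F)` corresponding to `M_v`, measure giving `K_p(F)` measure `1`; `orb = O_h(f^p) = ∫_{G_h(𝔸_f^p)\G(𝔸_f^p)} f^p(g⁻¹hg)`
(1.5.7), `f^p` the characteristic function of `K^p`, measure giving `K^p` measure `1`.
[cite: Kottwitz1984TwistedOrbital, §1.5 (1.5.3)–(1.5.7) (p. 292)] -/
structure CountDatum where
  /-- `Card(I_h(ℚ)\A_h)` -/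
  cardQuot : ℕ
  /-- `a = meas(I_h(ℚ)Z_K\I_h(𝔸_f))` -/
  a : ℝ
  /-- `TO_δ(φ_p)` -/
  twistedOrb : ℝ
  /-- `O_h(f^p)` -/
  orb : ℝ

namespace CountDatum

/-- **[Kottwitz1984TwistedOrbital, (1.5.3)–(1.5.4)]** (p. 292), AS PRINTED: «The cardinality of `I_h(ℚ)\A_h` is equal to (1.5.3)
`∫ φ_p(g₁⁻¹δσ(g₁)) f^p(g₂⁻¹hg₂) dg₁dg₂/dx` […] We can rewrite (1.5.3) as (1.5.4) `a · TO_δ(φ_p) · O_h(f^p)`» with `a`, `TO_δ(φ_p)`,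
`O_h(f^p)` as in (1.5.5)–(1.5.7).  Nothing is asserted. [cite: Kottwitz1984TwistedOrbital, (1.5.3)–(1.5.7) (p. 292)] -/
def Eq154 (D : CountDatum) : Prop :=
  (D.cardQuot : ℝ) = D.a * D.twistedOrb * D.orb

end CountDatum

/-! ## Discharges of the concrete §1.4 predicates (they hold as stated; kernel-checked bookkeeping, no new statement) -/

section Discharges

variable {I : Type u} [Group I] {Xp : Type v} {XP : Type w} [MulAction I Xp] [MulAction I XP]

/-- (1.4.4) holds as typed: the fibre of `A` over `h` is `Y_p × Y^p`. [cite: Kottwitz1984TwistedOrbital, (1.4.4) (p. 290)] -/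
theorem Eq144_holds : ∀ Φ : Xp → Xp, Eq144 (I := I) (XP := XP) Φ := by
  intro Φ h
  ext ⟨x, y⟩
  simp only [fixedPointData, Yp, YP, Set.mem_setOf_eq, Set.mem_prod]
  constructor
  · rintro ⟨h1, h2⟩
    exact ⟨by rw [h1, inv_smul_smul], h2.symm⟩
  · rintro ⟨h1, h2⟩
    refine ⟨?_, h2.symm⟩
    calc Φ x = h • (h⁻¹ • Φ x) := (smul_inv_smul h (Φ x)).symm
      _ = h • x := by rw [h1]

/-- (1.4.2), surjectivity half, holds as typed. [cite: Kottwitz1984TwistedOrbital, (1.4.2) (p. 290)] -/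
theorem Surj142_holds : ∀ Φ : Xp → Xp, Surj142 (I := I) (XP := XP) Φ := by
  intro Φ hΦ x y
  constructor
  · intro h
    obtain ⟨g', h1, h2⟩ := h 1
    rw [one_smul] at h1 h2
    exact ⟨g', h1, h2⟩
  · rintro ⟨h, h1, h2⟩ g
    refine ⟨g * h, ?_, ?_⟩
    · rw [hΦ, mul_smul, ← h1]
    · rw [mul_smul, ← h2]

/-- (1.4.2), injectivity half, holds as typed (from (1.3.7)). [cite: Kottwitz1984TwistedOrbital, (1.4.2) (p. 290)] -/
theorem Inj142_holds : ∀ (ZK : Subgroup I) (Φ : Xp → Xp), Inj142 (XP := XP) ZK Φ := by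
  intro ZK Φ hΦ h137 t ht t' ht'
  obtain ⟨h, x, y⟩ := t
  obtain ⟨h', x', y'⟩ := t'
  simp only [fixedPointData, Set.mem_setOf_eq] at ht ht' ⊢
  obtain ⟨hx, hy⟩ := ht
  obtain ⟨hx', hy'⟩ := ht'
  constructor
  · rintro ⟨g, hgx, hgy⟩
    have e1 : (g * h * g⁻¹) • x' = h' • x' := by
      rw [← hx', hgx, hΦ, hx, smul_smul, smul_smul, inv_mul_cancel_right]
    have e2 : (g * h * g⁻¹) • y' = y' := by
      rw [hgy, smul_smul]
      calc (g * h * g⁻¹ * g) • y = (g * h) • y := by rw [inv_mul_cancel_right]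
        _ = g • (h • y) := mul_smul g h y
        _ = g • y := by rw [← hy]
    refine ⟨g, h' * (g * h * g⁻¹)⁻¹, ?_, (inv_mul_cancel_right h' _).symm, hgx, hgy⟩
    apply h137
    refine ⟨h' • x', y', ?_, ?_⟩
    · calc (h' * (g * h * g⁻¹)⁻¹) • (h' • x') = (h' * (g * h * g⁻¹)⁻¹) • ((g * h * g⁻¹) • x') := by rw [e1]
        _ = h' • x' := by rw [smul_smul, inv_mul_cancel_right]
    · calc (h' * (g * h * g⁻¹)⁻¹) • y' = (h' * (g * h * g⁻¹)⁻¹) • ((g * h * g⁻¹) • y') := by rw [e2]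
        _ = h' • y' := by rw [smul_smul, inv_mul_cancel_right]
        _ = y' := hy'.symm
  · rintro ⟨g, z, -, -, hgx, hgy⟩
    exact ⟨g, hgx, hgy⟩

/-- The stabilizer computation behind (1.4.3) holds as typed (from (1.3.8) and the centrality of `Z(ℚ)_K`).
[cite: Kottwitz1984TwistedOrbital, (1.4.3) (p. 290)] -/
theorem Stab143_holds : ∀ ZK : Subgroup I, Stab143 ZK := by
  intro ZK hZ h138 h g z hz hfix
  have hzinv : z⁻¹ ∈ ZK := inv_mem hz
  have hc : z⁻¹ * h = h * z⁻¹ := (Subgroup.mem_center_iff.mp (hZ hzinv) h).symm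
  have hcomm : g * h * g⁻¹ = h * z⁻¹ := (eq_inv_mul_of_mul_eq hfix).trans hc
  have hz1 : z⁻¹ = 1 := h138 h g z⁻¹ hzinv hcomm
  refine ⟨inv_eq_one.mp hz1, ?_⟩
  rw [hz1, mul_one] at hcomm
  exact mul_inv_eq_iff_eq_mul.mp hcomm

end Discharges

/-! ## ED. 3 (TK-t08 g2): discharge of (1.1.3.1), surjectivity — it holds as typed -/

section Discharge1131

/-- **(1.1.3.1), surjectivity, holds as typed** (the printed argument, p. 288: take the representative `c ∈ C` of the `Ω`-orbit
of `μ`; for `γ ∈ Γ`, `γc` lies in `C` (`C` is `Γ`-stable) and in the `Ω`-orbit of `μ` (the orbit is `Γ`-stable and the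
actions are compatible), so `γc = c` by uniqueness of the representative).  Kernel-checked bookkeeping, no new statement.
[cite: Kottwitz1984TwistedOrbital, Lemma 1.1.3, proof (1.1.3.1) (p. 288)] -/
theorem Surj1131_holds :
    ∀ (Ω : Type u) (Γ : Type v) (X : Type w) [Group Ω] [Group Γ] [MulAction Ω X] [MulAction Γ X] [MulAction Γ Ω]
      (C : Set X), Surj1131 Ω Γ X C := by
  intro Ω Γ X _ _ _ _ _ C hcompat hfund hstab x hx
  obtain ⟨c, ⟨hcC, w, hwc⟩, huniq⟩ := hfund x
  refine ⟨w, fun γ => ?_⟩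
  rw [hwc]
  obtain ⟨w', hw'⟩ := hx γ
  have horbit : ∃ w'' : Ω, w'' • x = γ • c := by
    refine ⟨γ • w * w', ?_⟩
    rw [mul_smul, ← hw', ← hcompat, hwc]
  exact huniq (γ • c) ⟨hstab γ c hcC, horbit⟩

end Discharge1131

end Literature.NumberTheory.Kottwitz1984TwistedOrbital.PointsModP
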